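import Literature.AlgebraicGeometry.Surfaces.K3NikulinPicardLattice
import Literature.AlgebraicGeometry.Surfaces.NikulinLattice
import HarnessLib

/-!
# van Geemen–Sarti Prop. 2.2: the index-two even overlattices `Λ̃_{2d} ⊃ Λ_{2d} = ℤL ⊕ E₈(−2)` glued by `(L/2, v/2)`

[cite: VanGeemenSarti2007, Prop. 2.2 (and its proof)]

Van Geemen–Sarti, *Nikulin involutions on K3 surfaces*, Prop. 2.2: "… in case `L² ≡ 0 mod 4` we have that
either `NS(X) = Λ` or `NS(X) ≅ Λ̃` where `Λ̃ = Λ_{2d}~` is the unique even lattice containing `Λ` with `Λ̃/Λ ≅ ℤ/2ℤ`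
and such that `E₈(−2)` is a primitive sublattice of `Λ̃`." Proof: "The even lattices `Λ̃` which have `Λ` as
sublattice of finite index correspond to isotropic subgroups `H` of `A_L ⊕ A_E` … If `E₈(−2)` is a primitive
sublattice of `Λ̃`, `H` must have trivial intersection with both `A_L` and `A_E`. Since `A_E` is two-torsion, it
follows that `H` is generated by `((1/2)L, v/2)` for some `v ∈ E₈(−2)`. As `((1/2)L)² = d/2 mod 2ℤ` and
`(v/2)² ∈ ℤ/2ℤ`, for `H` to be isotropic, `d` must be even. Moreover, if `d = 4m+2` we must have `v² = 8k+4`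
for some `k` and if `d = 4m` we must have `v² = 8k`. Conversely, such a `v ∈ E₈(−2)` defines an isotropic
subgroup `⟨(L/2, v/2)⟩ ⊂ A_L ⊕ A_E` which corresponds to an overlattice `Λ̃`."

## What is here (`Λ^*`-model of `LatticeFormsOverlattices.lean` over `Λ = Λ_{2d} = geemenSartiLattice d`)

For `v = (0, y) ∈ E₈(−2) ⊂ Λ_{2d}` (`y ∈ ℤ⁸`, `v² = −2E₈(y,y)`):
* §1 the glue functional `(L/2 + v/2 . _) ∈ Λ^*` (`geemenSartiGlue d y`, `(a, x) ↦ d·a − E₈(y, x)`;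
  `two_smul_geemenSartiGlue`: `2(L/2 + v/2) = L + v`), its class `h = [(L/2, v/2)] ∈ A_Λ` of order `2`
  (`d ≠ 0`), `H = ℤ·h` of order `2`, and `q_Λ(h) = (L/2)² + (v/2)² = d/2 + v²/4 = (d − E₈(y,y))/2 mod 2ℤ`
  (`discriminantQuad_mk_geemenSartiGlue`);
* §2 **"for `H` to be isotropic, `d` must be even"** and the mod-8 conditions: `H` is `q_Λ`-isotropic iff
  `4 ∣ d − E₈(y,y)` (`isotropic_span_geemenSartiGlue_iff`), which forces `d` even (`even_of_isotropic`) and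
  `v² ≡ 0 (8)` if `4 ∣ d`, `v² ≡ 4 (8)` if `d ≡ 2 (4)` (`glue_sq_emod_eight_…`); conversely for every even `d`
  there is such a `v` (`exists_isotropic_geemenSartiGlue`: `v = α₁` resp. `α₁ + α₂`, two orthogonal roots);
* §3 **the overlattice `Λ̃ = L_H`** for isotropic `H` (`geemenSartiOverlatticeForm d y h`): an even lattice with
  `[Λ̃ : Λ] = 2` ("`Λ̃/Λ ≅ ℤ/2ℤ`"), rank `9`, `|A_{Λ̃}| = |d|·2⁷`, in which **`E₈(−2)` is primitive**
  (`inrSublattice_primitive_in_overlattice`).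

NOT here: the uniqueness of `Λ̃` up to isometry (van Geemen–Sarti use `W(E₈) ↠ O(q_E)`), and the geometric
half of Prop. 2.2 (`NS(X) = Λ` or `Λ̃`).
-/

noncomputable section

open Module Function Matrix
open LinearMap (BilinForm)
open LinearMap.BilinForm
open Literature.Topology.FourManifolds

namespace Literature.AlgebraicGeometry.Surfaces

variable (d : ℤ) (y : Fin 8 → ℤ)

/-! ### §1 The glue class `h = (L/2, v/2) ∈ A_L ⊕ A_E = A_{Λ_{2d}}` -/

/-- **`(L/2 + v/2 . _) ∈ Λ^*`** for `v = (0, y) ∈ E₈(−2)`: the functional `(a, x) ↦ d·a − E₈(y, x)` on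
`Λ_{2d} = ℤ × ℤ⁸` (indeed `(L . (a,x)) = 2d·a` and `(v . (a,x)) = −2E₈(y,x)`). [cite: VanGeemenSarti2007, Prop. 2.2 (proof: "`H` is generated by `((1/2)L, v/2)`")] -/
def geemenSartiGlue : Module.Dual ℤ (ℤ × (Fin 8 → ℤ)) :=
  d • LinearMap.fst ℤ ℤ (Fin 8 → ℤ) - (e8Form y).comp (LinearMap.snd ℤ ℤ (Fin 8 → ℤ))

/-- `(L/2 + v/2 . (a, x)) = d·a − E₈(y, x)`. [cite: VanGeemenSarti2007, Prop. 2.2 (proof)] -/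
@[simp] theorem geemenSartiGlue_apply (p : ℤ × (Fin 8 → ℤ)) : geemenSartiGlue d y p = d * p.1 - e8Form y p.2 := by
  simp [geemenSartiGlue]

/-- **`2 · (L/2 + v/2) = L + v = i_Λ(1, y)`.** [cite: VanGeemenSarti2007, Prop. 2.2 (proof)] -/
theorem two_smul_geemenSartiGlue : geemenSartiLattice d (1, y) = (2 : ℤ) • geemenSartiGlue d y := by
  refine LinearMap.ext fun p ↦ ?_
  rw [geemenSartiLattice_apply, LinearMap.smul_apply, geemenSartiGlue_apply, smul_eq_mul]
  ring

/-- `(L/2 + v/2 . g)_{Λ_ℚ} = g(L + v)/2`. [cite: VanGeemenSarti2007, Prop. 2.2 (proof)] -/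
theorem dualForm_geemenSartiGlue (hd : d ≠ 0) (g : Module.Dual ℤ (ℤ × (Fin 8 → ℤ))) :
    (geemenSartiLattice d).dualForm (geemenSartiGlue d y) g = (g (1, y) : ℚ) / 2 := by
  rw [(geemenSartiLattice d).dualForm_eq_div_of_apply_eq_smul (nondegenerate_geemenSartiLattice d hd) two_ne_zero
    (two_smul_geemenSartiGlue d y) g, Int.cast_ofNat]

/-- **`(L/2 + v/2)² = d/2 + v²/4 = (d − E₈(y,y))/2`** ("`((1/2)L)² = d/2`", "`(v/2)²`", `v² = −2E₈(y,y)`).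
[cite: VanGeemenSarti2007, Prop. 2.2 (proof)] -/
theorem dualForm_geemenSartiGlue_self (hd : d ≠ 0) :
    (geemenSartiLattice d).dualForm (geemenSartiGlue d y) (geemenSartiGlue d y) = ((d - e8Form y y : ℤ) : ℚ) / 2 := by
  rw [dualForm_geemenSartiGlue d y hd, geemenSartiGlue_apply, mul_one]

/-- **`(L/2, v/2) ∉ Λ`: the glue class `h = [(L/2, v/2)] ∈ A_Λ` is nonzero** (`d ≠ 0`; compare the values at `L`).
[cite: VanGeemenSarti2007, Prop. 2.2 (proof: "trivial intersection with both `A_L` and `A_E`")] -/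
theorem geemenSartiGlue_not_mem_range (hd : d ≠ 0) : geemenSartiGlue d y ∉ LinearMap.range (geemenSartiLattice d) := by
  rintro ⟨p, hp⟩
  have h := LinearMap.congr_fun hp (1, 0)
  simp only [geemenSartiLattice_apply, geemenSartiGlue_apply, map_zero, mul_one, mul_zero, add_zero, sub_zero] at h
  have h' : d * (2 * p.1 - 1) = 0 := by linarith
  rcases mul_eq_zero.1 h' with h1 | h1
  · exact hd h1
  · omega

/-- `h ≠ 0` in `A_Λ`. [cite: VanGeemenSarti2007, Prop. 2.2 (proof)] -/
theorem mk_geemenSartiGlue_ne_zero (hd : d ≠ 0) :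
    (Submodule.Quotient.mk (geemenSartiGlue d y) : (geemenSartiLattice d).discriminantGroup) ≠ 0 := by
  rw [Ne, Submodule.Quotient.mk_eq_zero]
  exact geemenSartiGlue_not_mem_range d y hd

/-- `2h = [L + v] = 0` in `A_Λ`. [cite: VanGeemenSarti2007, Prop. 2.2 (proof)] -/
theorem two_smul_mk_geemenSartiGlue :
    (2 : ℤ) • (Submodule.Quotient.mk (geemenSartiGlue d y) : (geemenSartiLattice d).discriminantGroup) = 0 := by
  rw [← Submodule.mkQ_apply, ← map_zsmul, Submodule.mkQ_apply, ← two_smul_geemenSartiGlue]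
  exact (geemenSartiLattice d).discriminantGroup_mk_apply (1, y)

/-- `h` has order `2`. [cite: VanGeemenSarti2007, Prop. 2.2 ("`Λ̃/Λ ≅ ℤ/2ℤ`")] -/
theorem addOrderOf_mk_geemenSartiGlue (hd : d ≠ 0) :
    addOrderOf (Submodule.Quotient.mk (geemenSartiGlue d y) : (geemenSartiLattice d).discriminantGroup) = 2 := by
  refine addOrderOf_eq_prime ?_ (mk_geemenSartiGlue_ne_zero d y hd)
  rw [← natCast_zsmul]
  exact two_smul_mk_geemenSartiGlue d y

/-- **`|H| = 2` for `H = ⟨(L/2, v/2)⟩`.** [cite: VanGeemenSarti2007, Prop. 2.2 ("`Λ̃/Λ ≅ ℤ/2ℤ`")] -/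
theorem natCard_span_mk_geemenSartiGlue (hd : d ≠ 0) :
    Nat.card (Submodule.span ℤ {(Submodule.Quotient.mk (geemenSartiGlue d y) : (geemenSartiLattice d).discriminantGroup)}) =
      2 :=
  natCard_span_singleton_of_addOrderOf _ (addOrderOf_mk_geemenSartiGlue d y hd)

/-- **`q_Λ(h) = (d − E₈(y,y))/2 mod 2ℤ`** (`= d/2 + v²/4`). [cite: VanGeemenSarti2007, Prop. 2.2 (proof)] -/
theorem discriminantQuad_mk_geemenSartiGlue (hd : d ≠ 0) :
    (geemenSartiLattice d).discriminantQuad (nondegenerate_geemenSartiLattice d hd) (isSymm_geemenSartiLattice d)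
        (isEven_geemenSartiLattice d) (Submodule.Quotient.mk (geemenSartiGlue d y)) =
      ((((d - e8Form y y : ℤ) : ℚ) / 2 : ℚ) : AddCircle (2 : ℚ)) := by
  rw [discriminantQuad_mk, dualForm_geemenSartiGlue_self d y hd]

/-! ### §2 "for `H` to be isotropic, `d` must be even"; the conditions mod `8`; existence of glue vectors -/

/-- **`H = ⟨(L/2, v/2)⟩` is `q_Λ`-isotropic iff `4 ∣ d − E₈(y, y)`** (i.e. iff `d/2 + v²/4 ∈ 2ℤ`).
[cite: VanGeemenSarti2007, Prop. 2.2 (proof)] -/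
theorem isotropic_span_geemenSartiGlue_iff (hd : d ≠ 0) :
    (∀ a ∈ Submodule.span ℤ {(Submodule.Quotient.mk (geemenSartiGlue d y) : (geemenSartiLattice d).discriminantGroup)},
        (geemenSartiLattice d).discriminantQuad (nondegenerate_geemenSartiLattice d hd) (isSymm_geemenSartiLattice d)
          (isEven_geemenSartiLattice d) a = 0) ↔
      (4 : ℤ) ∣ d - e8Form y y := by
  constructor
  · intro h
    have h1 := h _ (Submodule.mem_span_singleton_self _)
    rw [discriminantQuad_mk_geemenSartiGlue d y hd, AddCircle.coe_eq_zero_iff] at h1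
    obtain ⟨n, hn⟩ := h1
    refine ⟨n, Int.cast_injective (α := ℚ) ?_⟩
    rw [zsmul_eq_mul] at hn
    push_cast at hn ⊢
    linarith
  · rintro ⟨n, hn⟩ a ha
    rw [Submodule.mem_span_singleton] at ha
    obtain ⟨k, rfl⟩ := ha
    rw [discriminantQuad_smul, discriminantQuad_mk_geemenSartiGlue d y hd, hn]
    have h0 : ((((4 * n : ℤ) : ℚ) / 2 : ℚ) : AddCircle (2 : ℚ)) = 0 := by
      rw [AddCircle.coe_eq_zero_iff]
      exact ⟨n, by rw [zsmul_eq_mul]; push_cast; ring⟩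
    rw [h0, smul_zero]

/-- **"for `H` to be isotropic, `d` must be even"** (`E₈` is an even lattice). [cite: VanGeemenSarti2007, Prop. 2.2 (proof)] -/
theorem even_of_isotropic (h : (4 : ℤ) ∣ d - e8Form y y) : Even d := by
  obtain ⟨k, hk⟩ := isEven_e8Form y
  obtain ⟨n, hn⟩ := h
  exact ⟨2 * n + k, by omega⟩

/-- **"if `d = 4m` we must have `v² = 8k`"** (`v² = −2E₈(y,y)`). [cite: VanGeemenSarti2007, Prop. 2.2 (proof)] -/
theorem eight_dvd_glue_sq_of_four_dvd (h : (4 : ℤ) ∣ d - e8Form y y) (h4 : (4 : ℤ) ∣ d) :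
    (8 : ℤ) ∣ ((-2 : ℤ) • e8Form) y y := by
  rw [LinearMap.BilinForm.smul_apply_apply]
  obtain ⟨n, hn⟩ := h
  obtain ⟨m, hm⟩ := h4
  exact ⟨n - m, by linarith⟩

/-- **"if `d = 4m+2` we must have `v² = 8k+4`".** [cite: VanGeemenSarti2007, Prop. 2.2 (proof)] -/
theorem glue_sq_emod_eight_of_emod_four (h : (4 : ℤ) ∣ d - e8Form y y) (h2 : d % 4 = 2) :
    ((-2 : ℤ) • e8Form) y y % 8 = 4 := by
  rw [LinearMap.BilinForm.smul_apply_apply]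
  obtain ⟨n, hn⟩ := h
  omega

/-- `E₈(α₁, α₁) = 2` for the first simple root (a norm-`2` vector of `E₈`). [cite: VanGeemenSarti2007, Prop. 2.2 (proof: "`v² = 8k+4`", e.g. a root of `E₈(−2)` has `v² = −4`)] -/
theorem e8Form_single_zero : e8Form (Pi.single 0 1) (Pi.single 0 1) = 2 := by
  simp [e8Form, Matrix.toBilin'_apply', CartanMatrix.E₈, Matrix.mulVec, dotProduct, Matrix.of_apply, Pi.single_apply]

/-- `E₈(α₁ + α₂, α₁ + α₂) = 4` (`α₁ ⊥ α₂` in Bourbaki's numbering of `CartanMatrix.E₈`). [cite: VanGeemenSarti2007, Prop. 2.2 (proof: "`v² = 8k`")] -/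
theorem e8Form_single_zero_add_single_one :
    e8Form (Pi.single 0 1 + Pi.single 1 1) (Pi.single 0 1 + Pi.single 1 1) = 4 := by
  simp [e8Form, Matrix.toBilin'_apply', CartanMatrix.E₈, Matrix.mulVec, dotProduct, Fin.sum_univ_succ, Matrix.of_apply,
    Pi.single_apply, Pi.add_apply]

/-- **"Conversely, such a `v ∈ E₈(−2)` defines an isotropic subgroup"**: for every EVEN `d` there is a glue
vector, `v = α₁` (`v² = −4`) if `d ≡ 2 (4)` and `v = α₁ + α₂` (`v² = −8`) if `4 ∣ d`. [cite: VanGeemenSarti2007, Prop. 2.2 (proof)] -/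
theorem exists_isotropic_geemenSartiGlue (hd : Even d) : ∃ y : Fin 8 → ℤ, (4 : ℤ) ∣ d - e8Form y y := by
  obtain ⟨m, rfl⟩ := hd
  rcases Int.even_or_odd m with ⟨j, rfl⟩ | ⟨j, rfl⟩
  · exact ⟨Pi.single 0 1 + Pi.single 1 1, by rw [e8Form_single_zero_add_single_one]; exact ⟨j - 1, by ring⟩⟩
  · exact ⟨Pi.single 0 1, by rw [e8Form_single_zero]; exact ⟨j, by ring⟩⟩

/-! ### §3 The overlattice `Λ̃ = Λ_{2d}~ = L_H`, even of index `2`, with `E₈(−2)` primitive -/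

/-- The subgroup `H = ⟨(L/2, v/2)⟩ ⊂ A_{Λ_{2d}}`. [cite: VanGeemenSarti2007, Prop. 2.2 (proof)] -/
abbrev geemenSartiGlueSubgroup : Submodule ℤ (geemenSartiLattice d).discriminantGroup :=
  Submodule.span ℤ {Submodule.Quotient.mk (geemenSartiGlue d y)}

/-- **`Λ̃ := L_H ⊂ Λ^*`, the module generated by `Λ_{2d}` and `(L/2, v/2)`** (a lattice exactly when `H` is
isotropic). [cite: VanGeemenSarti2007, Prop. 2.2 ("corresponds to an overlattice `Λ̃`")] -/
abbrev geemenSartiOverlattice : Submodule ℤ (Module.Dual ℤ (ℤ × (Fin 8 → ℤ))) :=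
  (geemenSartiLattice d).overlattice (geemenSartiGlueSubgroup d y)

/-- `(L/2, v/2) ∈ Λ̃`. [cite: VanGeemenSarti2007, Prop. 2.2 (proof)] -/
theorem geemenSartiGlue_mem_overlattice : geemenSartiGlue d y ∈ geemenSartiOverlattice d y :=
  Submodule.mem_span_singleton_self _

/-- `Λ ⊂ Λ̃`. [cite: VanGeemenSarti2007, Prop. 2.2 ("`Λ̃` … containing `Λ`")] -/
theorem range_le_geemenSartiOverlattice : LinearMap.range (geemenSartiLattice d) ≤ geemenSartiOverlattice d y :=
  (geemenSartiLattice d).range_le_overlattice _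

variable {d y}

/-- For isotropic `H`, the `ℚ`-valued pairing is integral on `Λ̃`. [cite: VanGeemenSarti2007, Prop. 2.2 (proof)] [cite: Huybrechts2016K3, Ch. 14 §0.2] -/
theorem geemenSartiOverlattice_integral (hd : d ≠ 0) (h : (4 : ℤ) ∣ d - e8Form y y) :
    ∀ f ∈ geemenSartiOverlattice d y, ∀ g ∈ geemenSartiOverlattice d y, ∃ n : ℤ, (geemenSartiLattice d).dualForm f g = n :=
  (((geemenSartiLattice d).forall_discriminantQuad_eq_zero_iff_integral_even (nondegenerate_geemenSartiLattice d hd)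
    (isSymm_geemenSartiLattice d) (isEven_geemenSartiLattice d) _).1 ((isotropic_span_geemenSartiGlue_iff d y hd).2 h)).1

/-- **The even lattice `Λ̃ = Λ_{2d}~`** (for `4 ∣ d − E₈(y,y)`): `L_H` with its integral form.
[cite: VanGeemenSarti2007, Prop. 2.2 ("`Λ̃ = Λ_{2d}~` is the … even lattice containing `Λ` with `Λ̃/Λ ≅ ℤ/2ℤ`")] -/
def geemenSartiOverlatticeForm (hd : d ≠ 0) (h : (4 : ℤ) ∣ d - e8Form y y) : BilinForm ℤ (geemenSartiOverlattice d y) :=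
  (geemenSartiLattice d).integralForm _ (geemenSartiOverlattice_integral hd h)

/-- **`Λ̃` is even.** [cite: VanGeemenSarti2007, Prop. 2.2] -/
theorem isEven_geemenSartiOverlatticeForm (hd : d ≠ 0) (h : (4 : ℤ) ∣ d - e8Form y y) :
    (geemenSartiOverlatticeForm hd h).IsEven :=
  ((geemenSartiLattice d).isEven_integralForm_overlattice_iff (nondegenerate_geemenSartiLattice d hd)
    (isSymm_geemenSartiLattice d) (isEven_geemenSartiLattice d) _ _).2 ((isotropic_span_geemenSartiGlue_iff d y hd).2 h)

/-- `Λ̃` is symmetric. [cite: VanGeemenSarti2007, Prop. 2.2] -/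
theorem isSymm_geemenSartiOverlatticeForm (hd : d ≠ 0) (h : (4 : ℤ) ∣ d - e8Form y y) :
    (geemenSartiOverlatticeForm hd h).IsSymm :=
  (geemenSartiLattice d).isSymm_integralForm (nondegenerate_geemenSartiLattice d hd) (isSymm_geemenSartiLattice d) _ _

/-- `Λ̃` is nondegenerate. [cite: VanGeemenSarti2007, Prop. 2.2] -/
theorem nondegenerate_geemenSartiOverlatticeForm (hd : d ≠ 0) (h : (4 : ℤ) ∣ d - e8Form y y) :
    (geemenSartiOverlatticeForm hd h).Nondegenerate :=
  (geemenSartiLattice d).nondegenerate_integralForm (nondegenerate_geemenSartiLattice d hd) (isSymm_geemenSartiLattice d)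
    _ (range_le_geemenSartiOverlattice d y) _

/-- **`[Λ̃ : Λ] = 2`, i.e. `Λ̃/Λ ≅ ℤ/2ℤ`.** [cite: VanGeemenSarti2007, Prop. 2.2 ("`Λ̃/Λ ≅ ℤ/2ℤ`")] -/
theorem index_geemenSartiOverlattice (hd : d ≠ 0) :
    (LinearMap.range ((geemenSartiLattice d).toOverlattice (geemenSartiOverlattice d y)
        (range_le_geemenSartiOverlattice d y))).toAddSubgroup.index = 2 := by
  rw [index_range_toOverlattice_overlattice, natCard_span_mk_geemenSartiGlue d y hd]

/-- `rk Λ̃ = 9`. [cite: VanGeemenSarti2007, Prop. 2.2] -/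
theorem finrank_geemenSartiOverlattice (hd : d ≠ 0) : finrank ℤ (geemenSartiOverlattice d y) = 9 := by
  rw [(geemenSartiLattice d).finrank_overlattice_eq (nondegenerate_geemenSartiLattice d hd) _
    (range_le_geemenSartiOverlattice d y), finrank_geemenSartiLattice_carrier]

/-- **`|A_{Λ̃}| = |d| · 2⁷`** (`|A_{Λ̃}| · [Λ̃ : Λ]² = |A_Λ| = 2|d| · 2⁸`). [cite: VanGeemenSarti2007, Prop. 2.2] [cite: Huybrechts2016K3, Ch. 14 §0.1 (0.1)] -/
theorem natCard_discriminantGroup_geemenSartiOverlatticeForm (hd : d ≠ 0) (h : (4 : ℤ) ∣ d - e8Form y y) :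
    Nat.card (geemenSartiOverlatticeForm hd h).discriminantGroup = d.natAbs * 2 ^ 7 := by
  have h1 := (geemenSartiLattice d).natCard_discriminantGroup_integralForm_mul_sq (nondegenerate_geemenSartiLattice d hd)
    (isSymm_geemenSartiLattice d) _ (range_le_geemenSartiOverlattice d y) (geemenSartiOverlattice_integral hd h)
  rw [map_mkQ_overlattice, natCard_span_mk_geemenSartiGlue d y hd, natCard_discriminantGroup_geemenSartiLattice,
    Int.natAbs_mul, show (2 : ℤ).natAbs * d.natAbs * 2 ^ 8 = d.natAbs * 2 ^ 7 * 2 ^ 2 by norm_num; ring] at h1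
  exact Nat.eq_of_mul_eq_mul_right (by positivity) h1

/-- **The classes of `Λ̃` mod `Λ` are `0` and `h`**: every `g ∈ Λ̃` lies in `Λ` or in `(L/2, v/2) + Λ`.
[cite: VanGeemenSarti2007, Prop. 2.2 ("`Λ̃/Λ ≅ ℤ/2ℤ`")] -/
theorem mem_range_or_sub_glue_mem_range {g : Module.Dual ℤ (ℤ × (Fin 8 → ℤ))} (hg : g ∈ geemenSartiOverlattice d y) :
    g ∈ LinearMap.range (geemenSartiLattice d) ∨ g - geemenSartiGlue d y ∈ LinearMap.range (geemenSartiLattice d) := by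
  rw [geemenSartiOverlattice, mem_overlattice_iff, geemenSartiGlueSubgroup, Submodule.mem_span_singleton] at hg
  obtain ⟨m, hm⟩ := hg
  have h2 := two_smul_mk_geemenSartiGlue d y
  rcases Int.even_or_odd m with ⟨j, rfl⟩ | ⟨j, rfl⟩
  · left
    rw [← Submodule.Quotient.mk_eq_zero, ← hm, ← two_mul, mul_comm, mul_smul, h2]
    exact smul_zero j
  · right
    rw [← Submodule.Quotient.eq, ← hm, add_smul, one_smul, mul_comm, mul_smul, h2,
      show j • (0 : (geemenSartiLattice d).discriminantGroup) = 0 from smul_zero j, zero_add]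

/-- **`E₈(−2)` is a primitive sublattice of `Λ̃`**: if `k·g ∈ i_Λ(E₈(−2))` for `g ∈ Λ̃` and `k ≠ 0`, then
`g ∈ i_Λ(E₈(−2))` (`i_Λ(E₈(−2)) = {i_Λ(0, x)}`; the class `h` has nonzero `A_L`-component). [cite: VanGeemenSarti2007, Prop. 2.2 ("such that `E₈(−2)` is a primitive sublattice of `Λ̃`"; proof: "`H` must have trivial intersection with both `A_L` and `A_E`")] -/
theorem inrSublattice_primitive_in_overlattice (hd : d ≠ 0) (k : ℤ) (hk : k ≠ 0)
    {g : Module.Dual ℤ (ℤ × (Fin 8 → ℤ))} (hg : g ∈ geemenSartiOverlattice d y)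
    (hkg : ∃ x : Fin 8 → ℤ, k • g = geemenSartiLattice d (0, x)) : ∃ x : Fin 8 → ℤ, g = geemenSartiLattice d (0, x) := by
  have hinj := (geemenSartiLattice d).injective_of_nondegenerate (nondegenerate_geemenSartiLattice d hd)
  obtain ⟨x', hx'⟩ := hkg
  rcases mem_range_or_sub_glue_mem_range hg with ⟨p, rfl⟩ | ⟨p, hp⟩
  · -- `g = i_Λ(p)`, `k p = (0, x')`
    have h1 : k • p = (0, x') := hinj (by rw [map_smul, hx'])
    refine ⟨p.2, ?_⟩
    have h2 : p.1 = 0 := by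
      have := congrArg Prod.fst h1
      simp only [Prod.smul_fst, smul_eq_mul] at this
      exact (mul_eq_zero.1 this).resolve_left hk
    rw [show p = (0, p.2) from Prod.ext h2 rfl]
  · -- `g = (L/2, v/2) + i_Λ(p)`: then `k (L/2, v/2) ∈ Λ`, forcing `k` even, `k = 2a'`, and `a'(1 + 2p₁) = 0`
    exfalso
    have hg' : g = geemenSartiGlue d y + geemenSartiLattice d p := by rw [hp]; abel
    -- evaluate `k g = i_Λ(0, x')` at `L = (1, 0)` : `k (d + 2d p₁) = 0`
    have h1 := LinearMap.congr_fun hx' (1, 0)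
    rw [hg', LinearMap.smul_apply, LinearMap.add_apply, geemenSartiGlue_apply, geemenSartiLattice_apply,
      geemenSartiLattice_apply] at h1
    simp only [map_zero, mul_one, mul_zero, sub_zero, add_zero, smul_eq_mul] at h1
    have h3 : k * d * (1 + 2 * p.1) = 0 := by linarith
    rcases mul_eq_zero.1 h3 with h4 | h4
    · rcases mul_eq_zero.1 h4 with h5 | h5
      · exact hk h5
      · exact hd h5
    · omega

/-- In particular (`k = 1` is trivial; `k = 2`): **`ℤL` meets `Λ̃` as it meets `Λ`** — the glue class is not in
`A_E`: `(L/2, v/2) − i_Λ(0, x) ∉ Λ` for all `x`. [cite: VanGeemenSarti2007, Prop. 2.2 (proof: "trivial intersection with … `A_E`")] -/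
theorem geemenSartiGlue_sub_inr_not_mem_range (hd : d ≠ 0) (x : Fin 8 → ℤ) :
    geemenSartiGlue d y - geemenSartiLattice d (0, x) ∉ LinearMap.range (geemenSartiLattice d) := by
  rintro ⟨p, hp⟩
  apply geemenSartiGlue_not_mem_range d y hd
  exact ⟨p + (0, x), by rw [map_add, hp, sub_add_cancel]⟩

end Literature.AlgebraicGeometry.Surfaces
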